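import Summits.Ventures.CertifiedQuantumChemistry.Rows.CIRayleighQuotient
import Literature.MathematicalPhysics.QuantumChemistry.SectorWeinsteinEnclosure
import Literature.MathematicalPhysics.QuantumChemistry.TempleThirringBoundsProofs
import HarnessLib

/-!
# Ventures/CertifiedQuantumChemistry — Rows/CISecondMoment.lean: the exact-`ℚ` SECOND MOMENT of a CI record, the Weinstein enclosure it certifies, and the Temple lower row it would certify given a gap

HONEST FRAMING (verbatim): certified bounds for a stated model Hamiltonian in a stated basis; not a
claim about the real molecule beyond that model.

LADDER-CHEM I-TYPE (cell chem-oracle, seat chem-type-06, next-slot (F2), 2026-08-26; zero compute; PROVED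
glue only, 0 sorry, no claim node; nothing here asserts a bound about any model). SIBLING of
`Rows/CIUpperBound.lean` (the record `CIVec k n`: determinants `det : Fin n → Finset (Orb (Fin k))`,
coefficients `coeff : Fin n → ℚ`; first moment `CIVec.energy F ψ = Σ_ij c_i c_j ⟨D_i|H_F|D_j⟩ ∈ ℚ` through the
Slater–Condon mirror `Model.slaterCondon`, norm `CIVec.normSq`) and `Rows/CIRayleighQuotient.lean`
(`CIVec.rayleighQuotient = energy / normSq`). This file adds the SECOND MOMENT and what it certifies:

* `CIVec.hSqMoment F ψ : ℚ := Σ_ij c_i c_j Σ_K ⟨D_i|H_F|K⟩⟨K|H_F|D_j⟩` — `⟨ψ, H_F² ψ⟩` as an exact rational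
  (sum over ALL occupation vectors `K`; only those within a double excitation of some `D_i` contribute), with
  the kernel bridges `CIVec.star_vec_dotProduct_hamiltonian_sq_mulVec : ⟨ψ, H_F·H_F ψ⟩ = hSqMoment` and, for a
  symmetric model, `CIVec.star_hamiltonian_mulVec_self : ⟨H_F ψ, H_F ψ⟩ = hSqMoment` (`≥ 0`);
* `CIVec.residualNormSq F ψ τ : ℚ := hSqMoment − 2τ·energy + τ²·normSq` = `‖H_F ψ − τ ψ‖²`
  (`CIVec.re_residual_self_eq`), nonnegative; `CIVec.variance F ψ : ℚ := hSqMoment/normSq − rayleighQuotient²`,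
  `residualNormSq` at `τ = rayleighQuotient` equals `normSq · variance` and `energy² ≤ normSq · hSqMoment`
  (Cauchy–Schwarz; `variance ≥ 0`);
* **Weinstein enclosure from a CI record** (`Literature/…/SectorWeinsteinEnclosure.lean`, Weinstein–Stenger
  (1972) Ch. 5 §9 eq. (1), p. 103; Horn–Johnson Thm 6.3.14 (b), p. 411): for a symmetric model, sector-pure
  determinants, `0 < normSq` and any rational `τ`, SOME eigenvalue `e` of `H_F` with an eigenvector in the
  `(a, b)` sector has `(e − τ)² · normSq ≤ residualNormSq F ψ τ` (`CIVec.exists_sectorEigen_sq_sub_mul_le`); the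
  slot form a reader decides in `ℚ`: `residualNormSq ≤ w² · normSq ⇒ |e − τ| ≤ w`
  (`CIVec.exists_sectorEigen_abs_sub_le`), and its upper-row reading `UpperRow F a b (τ + w)`
  (`CIVec.upperRow_of_residual`, weaker than the Rayleigh–Ritz row of the same record but stated for the index);
* **Temple's lower row from a CI record, MODULO THE GAP LEG** (`templeInequality_holds`,
  `Literature/…/TempleThirringBoundsProofs.lean`, Reed–Simon IV Thm XIII.5; Weinstein–Stenger (1972) Ch. 5 §9
  eq. (2), p. 104: "`λ₁ ≥ (Hw, w) − {[(Hw, Hw) − (Hw, w)²]/[ρ − (Hw, w)]}`"): IF every eigenvalue of `H_F` on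
  the `(a, b)` sector other than the least one is `≥ ρ` (a rational `ρ` — the leg door M1 of the cell must
  certify; NOT supplied here) and `rayleighQuotient < ρ`, THEN
  `LowerRow F a b (rayleighQuotient − variance / (ρ − rayleighQuotient))` (`CIVec.lowerRow_of_temple_gap`) —
  all three rationals from the record. Homogeneity (`ψ` need not be normalised) is handled inside.

WHAT THIS IS NOT: not a certificate class in use (no reader lineage evaluates `hSqMoment` yet); the Temple row
is CONDITIONAL on a gap hypothesis no certificate of the cell discharges today; a Weinstein interval never
bounds `E₀` from below by itself. Sources (pages opened): Weinstein–Stenger (1972) Ch. 5 §9 pp. 103–104;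
Horn–Johnson (2013) Thm 6.3.14 p. 411, Problem 6.3.P2 p. 412; Helgaker–Jørgensen–Olsen (2000) §4.2.3
(4.2.10)–(4.2.12) p. 113 (the CI expansion `|C⟩ = Σ_i C_i |i⟩` and `E(C) = ⟨C|Ĥ|C⟩/⟨C|C⟩`); §11.4.1
(the CI `σ`-vector `σ = HC`, of which `hSqMoment = σᵀσ` for real `C`) is cited for vocabulary only.
-/

namespace Summit.Ventures.CertifiedQuantumChemistry

open Matrix Finset
open Literature.MathematicalPhysics.QuantumLattice Literature.MathematicalPhysics.QuantumChemistry
open Literature.MathematicalPhysics.QuantumLattice.EigenvalueContinuation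

namespace CIVec

variable {k n : ℕ}

/-! ## The second moment `⟨ψ, H_F² ψ⟩` as a rational -/

/-- **Second moment of the CI record**: `⟨ψ, H_F² ψ⟩ = Σ_ij c_i c_j Σ_K ⟨D_i|H_F|K⟩ ⟨K|H_F|D_j⟩` as an exact
rational, every matrix element through the Slater–Condon mirror `Model.slaterCondon` (the inner sum runs over
all occupation vectors `K`; it is supported on the single and double excitations of `D_i` and `D_j`). For a
real CI vector this is `σᵀσ` for the `σ`-vector `σ = HC` of Helgaker–Jørgensen–Olsen (2000) §11.4.1; the
`(Hw, Hw)` of Weinstein–Stenger (1972) Ch. 5 §9, p. 103. [cite: WeinsteinStenger1972, Ch. 5 §9, p. 103] -/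
def hSqMoment (F : Model k) (ψ : CIVec k n) : ℚ :=
  ∑ i, ∑ j, ψ.coeff i * ψ.coeff j *
    ∑ K : Finset (Orb (Fin k)), F.slaterCondon (ψ.det i) K * F.slaterCondon K (ψ.det j)

/-- **Bridge**: `⟨ψ, (H_F·H_F) ψ⟩` is the rational `hSqMoment` (bilinear expansion + `(H·H)_{IJ} = Σ_K H_{IK}H_{KJ}`
+ the Slater–Condon mirror `Model.hamiltonian_apply_eq_slaterCondon`). [cite: WeinsteinStenger1972, Ch. 5 §9, p. 103] -/
theorem star_vec_dotProduct_hamiltonian_sq_mulVec (F : Model k) (ψ : CIVec k n) :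
    star ψ.vec ⬝ᵥ (F.hamiltonian * F.hamiltonian) *ᵥ ψ.vec = ((ψ.hSqMoment F : ℚ) : ℂ) := by
  rw [star_vec_dotProduct_mulVec, hSqMoment]
  push_cast
  simp only [Matrix.mul_apply, Model.hamiltonian_apply_eq_slaterCondon]

/-- **Bridge, symmetric model**: `⟨H_F ψ, H_F ψ⟩ = hSqMoment` (`H_F` Hermitian, so `⟨Hψ, Hψ⟩ = ⟨ψ, H²ψ⟩`).
[cite: WeinsteinStenger1972, Ch. 5 §9, p. 103] -/
theorem star_hamiltonian_mulVec_self {F : Model k} (hF : F.IsSymmetric) (ψ : CIVec k n) :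
    star (F.hamiltonian *ᵥ ψ.vec) ⬝ᵥ (F.hamiltonian *ᵥ ψ.vec) = ((ψ.hSqMoment F : ℚ) : ℂ) := by
  rw [star_mulVec, (Model.hamiltonian_isHermitian hF).eq, ← dotProduct_mulVec, mulVec_mulVec,
    star_vec_dotProduct_hamiltonian_sq_mulVec]

/-- The second moment of a symmetric model is nonnegative (`= ‖H_F ψ‖²`). [folklore] -/
theorem hSqMoment_nonneg {F : Model k} (hF : F.IsSymmetric) (ψ : CIVec k n) : 0 ≤ ψ.hSqMoment F := by
  have h := re_star_dotProduct_self_nonneg (F.hamiltonian *ᵥ ψ.vec)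
  rw [star_hamiltonian_mulVec_self hF, Complex.ratCast_re] at h
  exact_mod_cast h

/-! ## The residual norm and the variance -/

/-- **Residual norm of the record at a rational shift**: `‖H_F ψ − τψ‖² = ⟨ψ,H²ψ⟩ − 2τ⟨ψ,Hψ⟩ + τ²⟨ψ,ψ⟩` as the
rational `hSqMoment − 2τ·energy + τ²·normSq` — Weinstein–Stenger (1972) Ch. 5 §9, p. 103:
"`[φ(τ)]² = (Hw, Hw) − 2τ(Hw, w) + τ²`". [cite: WeinsteinStenger1972, Ch. 5 §9, p. 103] -/
def residualNormSq (F : Model k) (ψ : CIVec k n) (τ : ℚ) : ℚ :=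
  ψ.hSqMoment F - 2 * τ * ψ.energy F + τ ^ 2 * ψ.normSq

/-- **Bridge**: for a symmetric model, `Re ⟨H_F ψ − τψ, H_F ψ − τψ⟩ = residualNormSq F ψ τ` (the three moment
bridges and `re_residual_self_eq_moments`). [cite: WeinsteinStenger1972, Ch. 5 §9, p. 103] -/
theorem re_residual_self_eq {F : Model k} (hF : F.IsSymmetric) (ψ : CIVec k n) (τ : ℚ) :
    (star (F.hamiltonian *ᵥ ψ.vec - ((τ : ℚ) : ℂ) • ψ.vec) ⬝ᵥ
        (F.hamiltonian *ᵥ ψ.vec - ((τ : ℚ) : ℂ) • ψ.vec)).re = ((ψ.residualNormSq F τ : ℚ) : ℝ) := by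
  have h := re_residual_self_eq_moments (Model.hamiltonian_isHermitian hF) ψ.vec (τ : ℝ)
  rw [Complex.ofReal_ratCast] at h
  rw [h, star_vec_dotProduct_hamiltonian_sq_mulVec, star_vec_dotProduct_hamiltonian_mulVec,
    star_vec_dotProduct_vec, Complex.ratCast_re, Complex.ratCast_re, Complex.ratCast_re, residualNormSq]
  push_cast
  ring

/-- The residual norm is nonnegative at every shift (`= ‖H_F ψ − τψ‖²`). [folklore] -/
theorem residualNormSq_nonneg {F : Model k} (hF : F.IsSymmetric) (ψ : CIVec k n) (τ : ℚ) :
    0 ≤ ψ.residualNormSq F τ := by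
  have h := re_star_dotProduct_self_nonneg (F.hamiltonian *ᵥ ψ.vec - ((τ : ℚ) : ℂ) • ψ.vec)
  rw [re_residual_self_eq hF] at h
  exact_mod_cast h

/-- **Cauchy–Schwarz for the record**: `energy² ≤ normSq · hSqMoment` (`⟨ψ,Hψ⟩² ≤ ⟨ψ,ψ⟩⟨Hψ,Hψ⟩`), i.e. the
energy variance is nonnegative; from `residualNormSq ≥ 0` at the optimal shift. Horn–Johnson (2013) Problem
6.3.P2 (a)–(c), p. 412. [cite: HornJohnson2013, Problem 6.3.P2, p. 412] -/
theorem energy_sq_le_normSq_mul_hSqMoment {F : Model k} (hF : F.IsSymmetric) (ψ : CIVec k n) :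
    ψ.energy F ^ 2 ≤ ψ.normSq * ψ.hSqMoment F := by
  by_cases hpos : 0 < ψ.normSq
  · have h := residualNormSq_nonneg hF ψ (ψ.energy F / ψ.normSq)
    rw [residualNormSq] at h
    have key : ψ.hSqMoment F - 2 * (ψ.energy F / ψ.normSq) * ψ.energy F +
        (ψ.energy F / ψ.normSq) ^ 2 * ψ.normSq = (ψ.normSq * ψ.hSqMoment F - ψ.energy F ^ 2) / ψ.normSq := by
      field_simp
      ring
    rw [key] at h
    exact sub_nonneg.1 ((div_nonneg_iff.1 h).resolve_right (fun h' => absurd h'.2 (not_le.2 hpos)) |>.1)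
  · -- `normSq = 0`: the Fock vector vanishes, so `energy = 0`
    have hn : (star ψ.vec ⬝ᵥ ψ.vec).re ≤ 0 := by
      rw [star_vec_dotProduct_vec, Complex.ratCast_re]; exact_mod_cast not_lt.1 hpos
    have h0 : ψ.vec = 0 := by
      by_contra h0
      exact absurd (re_star_dotProduct_self_pos h0) (not_lt.2 hn)
    have he : ψ.energy F = 0 := by
      have := star_vec_dotProduct_hamiltonian_mulVec F ψ
      rw [h0, mulVec_zero, dotProduct_zero] at this
      exact_mod_cast this.symm
    have hs : 0 ≤ ψ.normSq * ψ.hSqMoment F := by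
      have := star_vec_dotProduct_vec ψ
      rw [h0, dotProduct_zero] at this
      have hz : ψ.normSq = 0 := by exact_mod_cast this.symm
      rw [hz, zero_mul]
    rw [he]
    simpa using hs

/-- **Energy variance of the CI record**: `Var = ⟨ψ,H²ψ⟩/⟨ψ,ψ⟩ − (⟨ψ,Hψ⟩/⟨ψ,ψ⟩)² = hSqMoment/normSq −
rayleighQuotient²` as a rational (junk value when `normSq = 0`; rows carry `0 < normSq`) — the squared half-width
`‖Ay‖₂² − (y*Ay)²` of Horn–Johnson (2013) Problem 6.3.P2 (c) (6.3.17), p. 412, for the normalised record.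
[cite: HornJohnson2013, Problem 6.3.P2 (6.3.17), p. 412] -/
def variance (F : Model k) (ψ : CIVec k n) : ℚ :=
  ψ.hSqMoment F / ψ.normSq - ψ.rayleighQuotient F ^ 2

/-- At the Rayleigh quotient the residual norm is `normSq · variance` (the optimal shift, Horn–Johnson Problem
6.3.P2 (a), p. 412). [cite: HornJohnson2013, Problem 6.3.P2, p. 412] -/
theorem residualNormSq_rayleighQuotient (F : Model k) (ψ : CIVec k n) (hpos : 0 < ψ.normSq) :
    ψ.residualNormSq F (ψ.rayleighQuotient F) = ψ.normSq * ψ.variance F := by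
  rw [residualNormSq, variance, rayleighQuotient_def]
  field_simp
  ring

/-- The variance of a symmetric model's record is nonnegative (`0 < normSq`). [cite: HornJohnson2013, Problem 6.3.P2, p. 412] -/
theorem variance_nonneg {F : Model k} (hF : F.IsSymmetric) (ψ : CIVec k n) (hpos : 0 < ψ.normSq) :
    0 ≤ ψ.variance F := by
  have h := residualNormSq_nonneg hF ψ (ψ.rayleighQuotient F)
  rw [residualNormSq_rayleighQuotient F ψ hpos] at h
  by_contra hv
  exact absurd h (not_le.2 (mul_neg_of_pos_of_neg hpos (not_le.1 hv)))

/-! ## Weinstein's enclosure certified by a CI record -/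

/-- **KERNEL ENTRY POINT — Weinstein enclosure from an exact CI record (squared form).** For a symmetric model
`F`, a record `ψ` with sector-pure determinants (`InSector a b`) and `0 < normSq`, and any rational shift `τ`:
there is an eigenvalue `e` of `H_F` WITH AN EIGENVECTOR IN THE `(a, b)` SECTOR such that
`(e − τ)² · normSq ≤ residualNormSq F ψ τ` — both sides of the hypothesis-free conclusion are the record's
rationals. Weinstein–Stenger (1972) Ch. 5 §9 eq. (1), p. 103; Horn–Johnson Thm 6.3.14 (b), (6.3.16), p. 411;
proved by `exists_sectorEigen_sq_sub_mul_le_of_commute` (`SectorWeinsteinEnclosure.lean`: Rayleigh–Ritz for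
`(H_F − τ)²` on the sector; `H_F` commutes with `N̂`, `Ŝ_z`). [cite: WeinsteinStenger1972, Ch. 5 §9 eq. (1), p. 103] -/
theorem exists_sectorEigen_sq_sub_mul_le {F : Model k} (hF : F.IsSymmetric) (ψ : CIVec k n) {a b : ℕ}
    (hsec : ψ.InSector a b) (hpos : 0 < ψ.normSq) (τ : ℚ) :
    ∃ e : ℝ, (∃ v : Fock (Orb (Fin k)), IsInSector a b v ∧ v ≠ 0 ∧ F.hamiltonian *ᵥ v = (e : ℂ) • v) ∧
      (e - τ) ^ 2 * (ψ.normSq : ℝ) ≤ (ψ.residualNormSq F τ : ℝ) := by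
  obtain ⟨e, he, hle⟩ :=
    Literature.MathematicalPhysics.QuantumChemistry.exists_sectorEigen_sq_sub_mul_le_of_commute
      (Model.hamiltonian_isHermitian hF) (molecularHamiltonian_commute_totalNumber _ _ _)
      (molecularHamiltonian_commute_spinZ _ _ _) (isInSector_vec hsec) (vec_ne_zero_of_normSq_pos hpos)
      ((τ : ℚ) : ℝ)
  refine ⟨e, he, ?_⟩
  rw [Complex.ofReal_ratCast, re_residual_self_eq hF, star_vec_dotProduct_vec, Complex.ratCast_re] at hle
  exact hle

/-- **Weinstein enclosure from a CI record, slot form.** Same hypotheses, plus a rational half-width `w ≥ 0`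
with `residualNormSq F ψ τ ≤ w² · normSq` (ONE decidable inequality on the record's rationals): some eigenvalue
`e` of `H_F` with an eigenvector in the `(a, b)` sector satisfies `|e − τ| ≤ w`, i.e. `e ∈ [τ − w, τ + w]` —
"`τ − φ(τ) ≤ λ ≤ τ + φ(τ)`", Weinstein–Stenger (1972) Ch. 5 §9 eq. (1), p. 103 (with `w` any rational above
`φ = √(residualNormSq/normSq)`). [cite: WeinsteinStenger1972, Ch. 5 §9 eq. (1), p. 103] -/
theorem exists_sectorEigen_abs_sub_le {F : Model k} (hF : F.IsSymmetric) (ψ : CIVec k n) {a b : ℕ}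
    (hsec : ψ.InSector a b) (hpos : 0 < ψ.normSq) {τ w : ℚ} (hw : 0 ≤ w)
    (hle : ψ.residualNormSq F τ ≤ w ^ 2 * ψ.normSq) :
    ∃ e : ℝ, (∃ v : Fock (Orb (Fin k)), IsInSector a b v ∧ v ≠ 0 ∧ F.hamiltonian *ᵥ v = (e : ℂ) • v) ∧
      |e - τ| ≤ w := by
  obtain ⟨e, he, hsq⟩ := exists_sectorEigen_sq_sub_mul_le hF ψ hsec hpos τ
  refine ⟨e, he, ?_⟩
  have hposR : (0 : ℝ) < ψ.normSq := by exact_mod_cast hpos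
  have hleR : ((ψ.residualNormSq F τ : ℚ) : ℝ) ≤ (w : ℝ) ^ 2 * (ψ.normSq : ℝ) := by exact_mod_cast hle
  have h2 : (e - τ) ^ 2 ≤ (w : ℝ) ^ 2 := le_of_mul_le_mul_right (hsq.trans hleR) hposR
  exact abs_le_of_sq_le_sq h2 (by exact_mod_cast hw)

/-- **Upper-row reading of a Weinstein enclosure.** Under the hypotheses of `exists_sectorEigen_abs_sub_le`,
the located sector eigenvalue bounds the sector ground energy from above (Rayleigh–Ritz at its eigenvector,
`upperRow_of_certificate`), so `UpperRow F a b (τ + w)`. (Weaker than the record's own Rayleigh–Ritz row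
`CIVec.upperRow_rayleighQuotient` whenever `τ` is the quotient; stated so that an enclosure certificate has a
row-level reading in the index.) Horn–Johnson Thm 4.2.2 p. 234 with Thm 6.3.14 (b) p. 411.
[cite: HornJohnson2013, Thm 6.3.14, p. 411] -/
theorem upperRow_of_residual {F : Model k} (hF : F.IsSymmetric) (ψ : CIVec k n) {a b : ℕ}
    (hsec : ψ.InSector a b) (hpos : 0 < ψ.normSq) {τ w : ℚ} (hw : 0 ≤ w)
    (hle : ψ.residualNormSq F τ ≤ w ^ 2 * ψ.normSq) : UpperRow F a b (τ + w) := by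
  obtain ⟨e, ⟨v, hv, hv0, hHv⟩, habs⟩ := exists_sectorEigen_abs_sub_le hF ψ hsec hpos hw hle
  refine upperRow_of_certificate hF ⟨v, hv, hv0, ?_⟩
  rw [hHv, dotProduct_smul, smul_eq_mul, Complex.re_ofReal_mul]
  have hvpos : 0 < (star v ⬝ᵥ v).re := re_star_dotProduct_self_pos hv0
  have he : e ≤ ((τ + w : ℚ) : ℝ) := by
    push_cast
    linarith [(abs_le.1 habs).2]
  exact mul_le_mul_of_nonneg_right he hvpos.le

/-! ## Temple's lower row from a CI record, modulo the gap leg -/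

/-- Rayleigh data of a real multiple: `Re ⟨c ψ, X (c ψ)⟩ = c² · Re ⟨ψ, X ψ⟩`. [folklore] -/
private theorem re_rayleigh_real_smul (X : Matrix (Finset (Orb (Fin k))) (Finset (Orb (Fin k))) ℂ)
    (c : ℝ) (v : Fock (Orb (Fin k))) :
    (star ((c : ℂ) • v) ⬝ᵥ X *ᵥ ((c : ℂ) • v)).re = c * c * (star v ⬝ᵥ X *ᵥ v).re := by
  rw [mulVec_smul, star_real_smul_dotProduct_real_smul, Complex.re_ofReal_mul]

/-- **KERNEL ENTRY POINT — Temple's lower row from an exact CI record, CONDITIONAL ON THE GAP LEG.** For a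
symmetric model `F`, a record `ψ` with sector-pure determinants and `0 < normSq`, and a rational `ρ` such that
(GAP LEG, hypothesis `hgap` — NOT supplied by this file or by any certificate of the cell today) every
eigenvalue of `H_F` with an eigenvector in the `(a, b)` sector other than the sector ground energy is `≥ ρ`, and
`rayleighQuotient F ψ < ρ`: `LowerRow F a b (rayleighQuotient − variance / (ρ − rayleighQuotient))` — Temple's
formula "`λ₁ ≥ (Hw, w) − {[(Hw, Hw) − (Hw, w)²] / [ρ − (Hw, w)]}`", Weinstein–Stenger (1972) Ch. 5 §9 eq. (2),
p. 104 (`(w, w) = 1`, `λ₁ < ρ < λ₂`); Reed–Simon IV Thm XIII.5. PROVED by instantiating the tree's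
`templeInequality_holds` (`TempleThirringBoundsProofs.lean`, chem-type-09) at the normalised Fock vector of the
record; the three rationals are the record's (homogeneity of degree `0` in `ψ`). Delta vs print: finite
dimension; sector; `ρ ≤ λ₂` allowed (Temple's hypothesis as typed there). [cite: WeinsteinStenger1972, Ch. 5 §9 eq. (2), p. 104] -/
theorem lowerRow_of_temple_gap {F : Model k} (hF : F.IsSymmetric) (ψ : CIVec k n) {a b : ℕ}
    (hsec : ψ.InSector a b) (hpos : 0 < ψ.normSq) {ρ : ℚ}
    (hgap : ∀ (e : ℝ) (v : Fock (Orb (Fin k))), IsInSector a b v → v ≠ 0 →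
      F.hamiltonian *ᵥ v = (e : ℂ) • v → e ≠ F.energy a b → ((ρ : ℚ) : ℝ) ≤ e)
    (hlt : ψ.rayleighQuotient F < ρ) :
    LowerRow F a b (ψ.rayleighQuotient F - ψ.variance F / (ρ - ψ.rayleighQuotient F)) := by
  classical
  obtain ⟨ha, hb, -⟩ := upperRow_rayleighQuotient hF ψ hsec hpos
  refine ⟨ha, hb, ?_⟩
  -- the sector, its invariance, and the gap hypothesis in `minEnergyOn` form
  set H := F.hamiltonian with hHdef
  have hH : H.IsHermitian := Model.hamiltonian_isHermitian hF
  set K : Submodule ℂ (Fock (Orb (Fin k))) := szSector (a + b) (((a : ℝ) - b) / 2) with hKdef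
  have hKH : ∀ v ∈ K, H *ᵥ v ∈ K := fun v hv =>
    mulVec_mem_szSector_of_commute (molecularHamiltonian_commute_totalNumber _ _ _)
      (molecularHamiltonian_commute_spinZ _ _ _) hv
  have hE : F.energy a b = H.minEnergyOn K := rfl
  have hgap' : ∀ (e : ℝ) (v : Fock (Orb (Fin k))), v ∈ K → v ≠ 0 → H *ᵥ v = (e : ℂ) • v →
      e ≠ H.minEnergyOn K → ((ρ : ℚ) : ℝ) ≤ e := fun e v hv hv0 hHv hne =>
    hgap e v ((mem_szSector_iff_isInSector a b v).1 hv) hv0 hHv (hE ▸ hne)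
  -- normalise the record's Fock vector
  have hψ0 : ψ.vec ≠ 0 := vec_ne_zero_of_normSq_pos hpos
  obtain ⟨c, hc, hcc, h1⟩ := exists_normalize hψ0
  have hφK : (c : ℂ) • ψ.vec ∈ K := K.smul_mem _ ((mem_szSector_iff_isInSector a b _).2 (isInSector_vec hsec))
  -- the normalised moments are the record's quotients
  have hn : (star ψ.vec ⬝ᵥ ψ.vec).re = (ψ.normSq : ℝ) := by rw [star_vec_dotProduct_vec, Complex.ratCast_re]
  have hnpos : (0 : ℝ) < ψ.normSq := by exact_mod_cast hpos
  have hcc' : c * c = 1 / (ψ.normSq : ℝ) := by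
    rw [hn] at hcc
    field_simp
    linarith [hcc]
  have hm1 : (star ((c : ℂ) • ψ.vec) ⬝ᵥ H *ᵥ ((c : ℂ) • ψ.vec)).re = ((ψ.rayleighQuotient F : ℚ) : ℝ) := by
    rw [re_rayleigh_real_smul, star_vec_dotProduct_hamiltonian_mulVec, Complex.ratCast_re, hcc',
      rayleighQuotient_def]
    push_cast
    field_simp
  have hm2 : (star ((c : ℂ) • ψ.vec) ⬝ᵥ (H * H) *ᵥ ((c : ℂ) • ψ.vec)).re =
      ((ψ.hSqMoment F / ψ.normSq : ℚ) : ℝ) := by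
    rw [re_rayleigh_real_smul, star_vec_dotProduct_hamiltonian_sq_mulVec, Complex.ratCast_re, hcc']
    push_cast
    field_simp
  have hlt' : (star ((c : ℂ) • ψ.vec) ⬝ᵥ H *ᵥ ((c : ℂ) • ψ.vec)).re < ((ρ : ℚ) : ℝ) := by
    rw [hm1]; exact_mod_cast hlt
  -- Temple's inequality at the normalised vector
  have hT := templeInequality_holds H hH K hKH ((ρ : ℚ) : ℝ) hgap' _ hφK h1 hlt'
  rw [hm1, hm2, ← hE] at hT
  refine le_trans (le_of_eq ?_) hT
  rw [variance]
  push_cast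
  ring

end CIVec

end Summit.Ventures.CertifiedQuantumChemistry
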